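/-
Copyright (c) 2026 the pub-hodgecm-mathlib formalisation cell (harness21).  Prover seat hodgecm-mathlib-LH4-p04 (g2), req620 Track A «(D-RAM) FOUR-FRAME» squad
(MS ROAD A, STAGE B brick B3 «DUALISABLE STRATA TABLE» of LH4-p10 (g2) `SPEC-StageB.v1` §B, dealt 2026-09-03T23:39:29Z; readback + three corrections 23:45:35Z,
refuter audit LH4-r01 (g2) BOX BU) — part 2: the table.  2026-09-04.
-/
import Summits.HodgeConjecture.HodgeConjecture.Theorems.F0P3cDyRamDiagonalHNFDualFrameValues   -- part 1 (this seat): `dualFrame_values`, `gram_values`; brings ★ TorusDefs, ★ (3c-i), ★ HNF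
import HarnessLib

/-!
# Crux `H413`, line LH4 «(D-RAM) FOUR-FRAME» road — unit U3_Laws (iii), MS ROAD A, STAGE B brick B3: «THE DUALISABLE STRATA TABLE» — a NORMALISED HNF lattice
# `(1 0 0; x ϖ^b 0; y z ϖ^c)·𝒪³` that is self-dual for SOME `σ`-fixed diagonal form lies in one of eight explicit strata (core, T₁, T₂, T₃, G₁, G₂, G₃, H)

Cell `hodgecm-mathlib` (D-0151), FLOOR 0, crux item H413 = `stmt-HodgeConjecture-24833`, route of record `HCCMUnconditional`; squad F0∕P3c∕LH4 (req618∕req620); registered stub served: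
`F0P3cDyRamFourFrameU3.stub_U3_stableModelSum` (MS).  THEOREMS ONLY (no `def`, no instance, no notation, no `sorry`, default heartbeats); lane
`--supports stmt-HodgeConjecture-24833 --as helper` (count-neutral).  MS = STAGE A ⊕ STAGE B (LH4-p11 (g0) ledger v3); STAGE B «N_tv = [k]_q» (LH4-p10 (g2)
`MEMO-stableLaw-finite.v2.LH4p10g2.md` §1–§4, `SPEC-StageB.v1.LH4p10g2.md` §B, B10 skeleton `B10-StableCountTypeZero.SKELETON.v1`): the dualisable normalised `T`-stable
lattices are partitioned by shape; this file is the HNF-side necessity table behind the axis-vector shape list `stub_B3_shapes` (typed over ★ `F0P3cDyRamDiagonalStrataDefs` in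
the sequel).

THE MATHEMATICS (MEMO v2 §3).  Let `M = latt V`, `V = (1 0 0; x ϖ^b 0; y z ϖ^c)` with `x, y, z ∈ 𝒪`, NORMALISED (`b = 0 ∨ |x| = 1`, `c = 0 ∨ |y| = 1 ∨ |z| = 1`; ★
`normalised_latt_hnf_iff`), and suppose `M` is a type-`0` vertex lattice of `diag(D)` with `D_i` `σ`-fixed and non-zero.  (1) `|D_i| = exp(2e_i)` is an EVEN power (`σ`-fixed elements
have even valuation — the datum's `hfix`).  (2) ★ (3c-i) `v_eq_rowSup_dualOne_of_rowSup_eq_one` pins `|D_i|` to the row maxima of the dual frame `U_1 = ((σV)ᵀ)⁻¹`: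
`|D₂| = exp c`, `|D₁| = max(exp b, |z|·exp(b+c))`, `|D₀| = max(1, |x|·exp b, |xz − yϖ^b|·exp(b+c))` (the AXIS EXPONENTS `a₂ = c`, `a₁ = b + max(0, c − v z)`,
`a₀ = max(b, b + c − v(xz − yϖ^b))` of MEMO §1 ∕ ★ B2 p855755).  (3) In the HNF basis the Gram matrix `G = (σV)ᵀ diag(D) V` is integral with `|det G| = 1` (★
`vertexTriple_of_latt_eq`): `|det G| = |ϖ|^{2(b+c)}·Π|D_i|` gives `Σ a_i = 2(b+c)`, and the two diagonal entries `G₁₁ = D₁N(ϖ^b) + D₂N(z)`, `G₀₀ = D₀ + D₁N(x) + D₂N(y)`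
(`N(t) = tσt`) kill every IRREGULAR shape by the ultrametric inequality (MEMO (3.1): when `b ≠ v z` the two terms of `G₁₁` have distinct valuations, so both are integral, i.e.
`v z ≥ c − b` and `2 v z ≥ c`; if both are strict, `D₀` is the unique dominant term of `G₀₀`, of valuation `> 1`).  What survives is the table below — with the two `|yϖ^ρ − xz|`
exponents `ρ + s` (G₁) and `ρ` (H) and the representative-invariant T₁ condition `|y − xz| ≤ |ϖ|^s` (three corrections to SPEC §B's transcription, confirmed by the refuter box BU;
`y − xzϖ^{−b}` mod `𝔭^c` is the lattice invariant of ★ `latt_hnf_eq_latt_hnf_iff`).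

WHAT IS PROVED (the dual-frame values `|D_i|` and the Gram values come packaged from part 1, `F0P3cDyRamDiagonalHNFDualFrameValues`).
* HEAD `dualisable_strata` — for `σ` valuation-preserving with even valuations on its fixed points, `|ϖ| = exp(−1)`, `x y z` integral, `latt V` normalised and dualisable:
  (core) `b = c = 0` ∨ (T₃ s) `c = 0, b = s, 2∣s, 2 ≤ s` ∨ (T₂ s) `b = 0, c = s, 2∣s, 2 ≤ s, |z| ≤ |ϖ^s|, |y| = 1` ∨ (T₁ s) `b = 0, c = s, 2∣s, 2 ≤ s, |z| = 1, |y − xz| ≤ |ϖ^s|`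
  ∨ (G₁ ρ s) `1 ≤ ρ, 2 ≤ s, 2∣s, b = ρ, c = 2ρ+s, |z| = |ϖ^ρ|, |y| = 1, |yϖ^ρ − xz| = |ϖ^{ρ+s}|` ∨ (G₂ ρ s) `…, b = ρ, c = 2ρ+s, |z| = |ϖ^{ρ+s}|, |y| = 1`
  ∨ (G₃ ρ s) `…, c = 2ρ, b = ρ+s, |z| = |ϖ^ρ|, |y| = 1` ∨ (H ρ) `1 ≤ ρ, b = ρ, c = 2ρ, |z| = |ϖ^ρ|, |y| = 1, |yϖ^ρ − xz| = |ϖ^ρ|`.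
  Necessity only; the strata are pairwise exclusive on sight (by `(b, c, v z)`).  Axis vectors: core `(0,0,0)`, T₃ `(s,s,0)`, T₂ `(s,0,s)`, T₁ `(0,s,s)`, G₁ `(2ρ, 2ρ+s, 2ρ+s)`,
  G₂ `(2ρ+s, 2ρ, 2ρ+s)`, G₃ `(2ρ+s, 2ρ+s, 2ρ)`, H `(2ρ, 2ρ, 2ρ)` (the sequel file reads them off with ★ B2).
HONEST LABEL.  Count-neutral (`--supports`); nothing printed is asserted; (MS) stays a PROVER TARGET (empirical census law — MEMO v2 is its paper proof, oracle-checked class by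
class); `HC_CM` is proved only modulo the 7 printed citations (2 remaining named inputs: hLiu418 = `stmt-HodgeConjecture-24832`, h413 = `stmt-HodgeConjecture-24833`) until rung 0 closes.

## References
* [Jacobowitz1962] R. Jacobowitz, *Hermitian forms over local fields*, Amer. J. Math. 84 (1962), §4 (Gram matrices under change of basis), §7 (unimodular lattices).
* [Kottwitz1986BaseChangeUnits] R. E. Kottwitz, *Base change for unit elements of Hecke algebras*, Compositio Math. 60 (1986), §1 pp. 240–241 (fixed-lattice counting by position).
* [Serre1980Trees] J.-P. Serre, *Trees*, Springer (1980), Ch. II §1.1 (lattices `g·𝒪^N`, Hermite normal forms, coordinate axes).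
-/

set_option autoImplicit false

noncomputable section

namespace Summit.HodgeConjecture.HodgeConjecture.Cruxes.H413.F0P3cDyRamDiagonalDualisableStrata

open Matrix
open Literature.NumberTheory.Automorphic Literature.NumberTheory.Automorphic.HermitianLattice
open Literature.NumberTheory.Automorphic.UnitaryLatticeTree
open Summit.HodgeConjecture.HodgeConjecture.Cruxes.H413.F0P3cDyRamDiagonalTorusDefs
open Summit.HodgeConjecture.HodgeConjecture.Cruxes.H413.F0P3cDyRamDiagonalStableLatticeHNF
open Summit.HodgeConjecture.HodgeConjecture.Cruxes.H413.F0P3cDyRamDiagonalHNFDualFrameValues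
open scoped Valued WithZero Matrix MatrixGroups

variable {K : Type*} [Field K] [Valued K ℤᵐ⁰]

/-- **B3 · «THE DUALISABLE STRATA TABLE»** (MS ROAD A, STAGE B; LH4-p10 (g2) SPEC §B with the three corrections of the 23:45:35Z readback).  Let `σ` preserve the valuation
and have even valuations on its non-zero fixed points, `|ϖ| = exp(−1)`, `x y z ∈ 𝒪`, and let the HNF lattice `M = (1 0 0; x ϖ^b 0; y z ϖ^c)·𝒪³` be NORMALISED and DUALISABLE
(self-dual for some `σ`-fixed non-degenerate diagonal form).  Then `(b, c, x, y, z)` lies in exactly one of the eight strata: (core) `b = c = 0`; (T₃ s) `c = 0`, `b = s ≥ 2` even;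
(T₂ s) `b = 0`, `c = s ≥ 2` even, `|z| ≤ |ϖ^s|`, `|y| = 1`; (T₁ s) `b = 0`, `c = s ≥ 2` even, `|z| = 1`, `|y − xz| ≤ |ϖ^s|`; (G₁ ρ s) `b = ρ ≥ 1`, `c = 2ρ + s`, `s ≥ 2` even,
`|z| = |ϖ^ρ|`, `|y| = 1`, `|yϖ^ρ − xz| = |ϖ^{ρ+s}|`; (G₂ ρ s) `b = ρ ≥ 1`, `c = 2ρ + s`, `s ≥ 2` even, `|z| = |ϖ^{ρ+s}|`, `|y| = 1`; (G₃ ρ s) `c = 2ρ`, `b = ρ + s`, `ρ ≥ 1`,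
`s ≥ 2` even, `|z| = |ϖ^ρ|`, `|y| = 1`; (H ρ) `b = ρ ≥ 1`, `c = 2ρ`, `|z| = |ϖ^ρ|`, `|y| = 1`, `|yϖ^ρ − xz| = |ϖ^ρ|`.  Proof = MEMO v2 §3: even axis exponents (★ (3c-i) +
`hfix`), `Σ a = 2(b+c)` (`|det Gram| = 1`), and the `G₁₁`∕`G₀₀` integrality eliminations. [cite: Jacobowitz1962, §4, §7] [cite: Kottwitz1986BaseChangeUnits, §1 pp. 240–241]
[cite: Serre1980Trees, II §1.1] -/
theorem dualisable_strata {σ : K →+* K} (hvσ : ∀ a, Valued.v (σ a) = Valued.v a)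
    (hfix : ∀ t : K, σ t = t → t ≠ 0 → ∃ n : ℤ, Valued.v t = WithZero.exp (2 * n))
    {ϖ : K} (hϖ : Valued.v ϖ = WithZero.exp (-1 : ℤ)) (b c : ℕ) {x y z : K}
    (hx : Valued.v x ≤ 1) (hy : Valued.v y ≤ 1) (hz : Valued.v z ≤ 1)
    (hn : IsNormalisedLattice (latt (Matrix.of ![![1, 0, 0], ![x, ϖ ^ b, 0], ![y, z, ϖ ^ c]])))
    (hdual : IsDualisableLattice σ ϖ (latt (Matrix.of ![![1, 0, 0], ![x, ϖ ^ b, 0], ![y, z, ϖ ^ c]]))) :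
    (b = 0 ∧ c = 0) ∨
    (∃ s : ℕ, c = 0 ∧ b = s ∧ 2 ∣ s ∧ 2 ≤ s) ∨
    (∃ s : ℕ, b = 0 ∧ c = s ∧ 2 ∣ s ∧ 2 ≤ s ∧ Valued.v z ≤ Valued.v (ϖ ^ s) ∧ Valued.v y = 1) ∨
    (∃ s : ℕ, b = 0 ∧ c = s ∧ 2 ∣ s ∧ 2 ≤ s ∧ Valued.v z = 1 ∧ Valued.v (y - x * z) ≤ Valued.v (ϖ ^ s)) ∨
    (∃ ρ s : ℕ, 1 ≤ ρ ∧ 2 ≤ s ∧ 2 ∣ s ∧ b = ρ ∧ c = 2 * ρ + s ∧ Valued.v z = Valued.v (ϖ ^ ρ) ∧ Valued.v y = 1 ∧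
      Valued.v (y * ϖ ^ ρ - x * z) = Valued.v (ϖ ^ (ρ + s))) ∨
    (∃ ρ s : ℕ, 1 ≤ ρ ∧ 2 ≤ s ∧ 2 ∣ s ∧ b = ρ ∧ c = 2 * ρ + s ∧ Valued.v z = Valued.v (ϖ ^ (ρ + s)) ∧ Valued.v y = 1) ∨
    (∃ ρ s : ℕ, 1 ≤ ρ ∧ 2 ≤ s ∧ 2 ∣ s ∧ c = 2 * ρ ∧ b = ρ + s ∧ Valued.v z = Valued.v (ϖ ^ ρ) ∧ Valued.v y = 1) ∨
    (∃ ρ : ℕ, 1 ≤ ρ ∧ b = ρ ∧ c = 2 * ρ ∧ Valued.v z = Valued.v (ϖ ^ ρ) ∧ Valued.v y = 1 ∧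
      Valued.v (y * ϖ ^ ρ - x * z) = Valued.v (ϖ ^ ρ)) := by
  -- ### unpack the dualising form; the dual-frame values and the Gram values (part 1)
  obtain ⟨D, hDfix, hM⟩ := hdual
  have hD0 : ∀ i, D i ≠ 0 := fun i => (hDfix i).2
  have hϖ0 : ϖ ≠ 0 := (Valuation.ne_zero_iff Valued.v).1 (by rw [hϖ]; exact WithZero.exp_ne_zero)
  obtain ⟨hA2, ⟨hA1b, hA1z, hA1eq⟩, ⟨-, -, hA0w, hA0eq⟩⟩ := dualFrame_values hvσ hϖ hD0 b c hx hy hz hn hM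
  obtain ⟨hG11, hG00, hdetG⟩ := gram_values hvσ hϖ0 D b c x y z hM
  -- valuations of powers of `ϖ`
  have hq : ∀ n : ℕ, Valued.v (ϖ ^ n) = WithZero.exp (-(n : ℤ)) := fun n => by
    rw [map_pow, hϖ, ← WithZero.exp_nsmul]
    congr 1
    simp
  have hq1 : ∀ n : ℕ, Valued.v (ϖ ^ n) ≤ 1 := fun n => by
    rw [hq, ← WithZero.exp_zero, WithZero.exp_le_exp]; omega
  have hq_eq_one : ∀ n : ℕ, Valued.v (ϖ ^ n) = 1 ↔ n = 0 := fun n => by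
    rw [hq, ← WithZero.exp_zero, WithZero.exp_inj]; omega
  -- ### evenness of the form's valuations (`D_i` is `σ`-fixed)
  obtain ⟨e₀, he₀⟩ := hfix (D 0) (hDfix 0).1 (hD0 0)
  obtain ⟨e₁, he₁⟩ := hfix (D 1) (hDfix 1).1 (hD0 1)
  obtain ⟨e₂, he₂⟩ := hfix (D 2) (hDfix 2).1 (hD0 2)
  -- ### normalisation, unfolded on the HNF coordinates
  have hN := (normalised_latt_hnf_iff hx hy hz (hq1 b) (hq1 c)).1 hn
  -- ### `|det G| = 1`: `e₀ + e₁ + e₂ = b + c`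
  have hdet : e₀ + e₁ + e₂ = (b : ℤ) + c := by
    simp only [map_mul, map_pow, hvσ, hϖ, he₀, he₁, he₂, ← WithZero.exp_nsmul, ← WithZero.exp_add, nsmul_eq_mul, mul_neg, mul_one] at hdetG
    rw [← WithZero.exp_zero, WithZero.exp_inj] at hdetG
    omega
  -- integer forms of the slot-2 and slot-1 facts
  have hc2 : (c : ℤ) = 2 * e₂ := by
    rw [he₂, WithZero.exp_inj] at hA2; omega
  have hb1 : (b : ℤ) ≤ 2 * e₁ := by
    rw [he₁, WithZero.exp_le_exp] at hA1b; exact hA1b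
  -- the valuation terms of `G₁₁` and `G₀₀`
  have vT1 : Valued.v (σ (ϖ ^ b) * D 1 * ϖ ^ b) = WithZero.exp (2 * e₁ - 2 * b) := by
    rw [map_mul, map_mul, hvσ, hq, he₁, ← WithZero.exp_add, ← WithZero.exp_add]; congr 1; ring
  have vT2 : Valued.v (σ z * D 2 * z) = Valued.v z * Valued.v z * WithZero.exp (c : ℤ) := by
    rw [map_mul, map_mul, hvσ, hA2]; ac_rfl
  have vS1 : Valued.v (σ x * D 1 * x) = Valued.v x * Valued.v x * WithZero.exp (2 * e₁) := by
    rw [map_mul, map_mul, hvσ, he₁]; ac_rfl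
  have vS2 : Valued.v (σ y * D 2 * y) = Valued.v y * Valued.v y * WithZero.exp (c : ℤ) := by
    rw [map_mul, map_mul, hvσ, hA2]; ac_rfl
  -- ### CASE ANALYSIS
  rcases Nat.eq_zero_or_pos c with hc0 | hcpos
  · -- `c = 0`: core or T₃ (`b` even)
    have hb2 : (b : ℤ) = 2 * e₁ := by
      rcases hA1eq with h | h
      · rw [he₁, WithZero.exp_inj] at h; omega
      · -- `|D₁| = |z|·exp b ≤ exp b`
        have hle : Valued.v (D 1) ≤ WithZero.exp (b : ℤ) := by
          rw [h, hc0, Nat.cast_zero, add_zero]; exact mul_le_of_le_one_left' hz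
        rw [he₁, WithZero.exp_le_exp] at hle
        omega
    rcases Nat.eq_zero_or_pos b with hb0 | hbpos
    · exact Or.inl ⟨hb0, hc0⟩
    · exact Or.inr (Or.inl ⟨b, hc0, rfl, by omega, by omega⟩)
  · -- `c ≥ 1`, hence `c` even and `c ≥ 2`
    have hc_even : 2 ∣ c := by omega
    have hc_two : 2 ≤ c := by omega
    rcases Nat.eq_zero_or_pos b with hb0 | hbpos
    · -- `b = 0`: T₁ or T₂
      subst hb0
      have hrow2 : Valued.v y = 1 ∨ Valued.v z = 1 := by
        rcases hN.2 with h | h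
        · exact absurd ((hq_eq_one c).1 h) (by omega)
        · exact h
      by_cases hz1 : Valued.v z = 1
      · -- T₁: `|z| = 1` forces `|D₁| = exp c`, `|D₀| = 1`, hence `|y − xz| ≤ |ϖ|^c`
        have h21 : (c : ℤ) ≤ 2 * e₁ := by
          have := hA1z; rw [hz1, one_mul, he₁, Nat.cast_zero, zero_add, WithZero.exp_le_exp] at this; exact this
        have he1c : 2 * e₁ = (c : ℤ) := by
          rcases hA1eq with h | h
          · rw [he₁, Nat.cast_zero, WithZero.exp_inj] at h; omega
          · rw [he₁, hz1, one_mul, Nat.cast_zero, zero_add, WithZero.exp_inj] at h; omega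
        have he00 : e₀ = 0 := by omega
        have hW : Valued.v (y - x * z) ≤ Valued.v (ϖ ^ c) := by
          have h := hA0w
          rw [he₀, he00, mul_zero, WithZero.exp_zero, pow_zero, mul_one, Nat.cast_zero, zero_add, Valuation.map_sub_swap] at h
          rw [hq]
          calc Valued.v (y - x * z) = Valued.v (y - x * z) * WithZero.exp (c : ℤ) * WithZero.exp (-(c : ℤ)) := by
                rw [mul_assoc, ← WithZero.exp_add, add_neg_cancel, WithZero.exp_zero, mul_one]
            _ ≤ 1 * WithZero.exp (-(c : ℤ)) := mul_le_mul' h le_rfl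
            _ = WithZero.exp (-(c : ℤ)) := one_mul _
        exact Or.inr (Or.inr (Or.inr (Or.inl ⟨c, rfl, rfl, hc_even, hc_two, hz1, hW⟩)))
      · -- T₂: `|z| < 1` so `|y| = 1`, `|xz − y| = 1`, `|D₀| = exp c`, `|D₁| = 1`, hence `|z| ≤ |ϖ|^c`
        have hy1 : Valued.v y = 1 := hrow2.resolve_right hz1
        have hzlt : Valued.v z < 1 := lt_of_le_of_ne hz hz1
        have hWeq : Valued.v (x * z - y * ϖ ^ 0) = 1 := by
          rw [pow_zero, mul_one, Valuation.map_sub_eq_of_lt_right]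
          · exact hy1
          · rw [hy1, map_mul]
            exact lt_of_le_of_lt (mul_le_of_le_one_left' hx) hzlt
        have he0c : 2 * e₀ = (c : ℤ) := by
          have hge : WithZero.exp (c : ℤ) ≤ Valued.v (D 0) := by
            have := hA0w; rwa [hWeq, one_mul, Nat.cast_zero, zero_add] at this
          rw [he₀, WithZero.exp_le_exp] at hge
          rcases hA0eq with h | h | h
          · rw [he₀, ← WithZero.exp_zero, WithZero.exp_inj] at h; omega
          · have hle : Valued.v (D 0) ≤ 1 := by rw [h, Nat.cast_zero, WithZero.exp_zero, mul_one]; exact hx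
            rw [he₀, ← WithZero.exp_zero, WithZero.exp_le_exp] at hle; omega
          · rw [he₀, hWeq, one_mul, Nat.cast_zero, zero_add, WithZero.exp_inj] at h; omega
        have he10 : e₁ = 0 := by omega
        have hzc : Valued.v z ≤ Valued.v (ϖ ^ c) := by
          have h := hA1z
          rw [he₁, he10, mul_zero, WithZero.exp_zero, Nat.cast_zero, zero_add] at h
          rw [hq]
          calc Valued.v z = Valued.v z * WithZero.exp (c : ℤ) * WithZero.exp (-(c : ℤ)) := by
                rw [mul_assoc, ← WithZero.exp_add, add_neg_cancel, WithZero.exp_zero, mul_one]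
            _ ≤ 1 * WithZero.exp (-(c : ℤ)) := mul_le_mul' h le_rfl
            _ = WithZero.exp (-(c : ℤ)) := one_mul _
        exact Or.inr (Or.inr (Or.inl ⟨c, rfl, rfl, hc_even, hc_two, hzc, hy1⟩))
    · -- `b ≥ 1`: `|x| = 1`; the off-branch strata
      have hx1 : Valued.v x = 1 := by
        rcases hN.1 with h | h
        · exact absurd ((hq_eq_one b).1 h) (by omega)
        · exact h
      -- (i) `|ϖ|^c < |z|`: otherwise `|D₁| = exp b`, `|D₀| = exp(b+c)` would be attained by `|xz − yϖ^b| < 1` — impossible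
      have hzc : Valued.v (ϖ ^ c) < Valued.v z := by
        by_contra hle
        rw [not_lt] at hle
        have h2e1 : 2 * e₁ = (b : ℤ) := by
          have hzle : Valued.v z * WithZero.exp ((b : ℤ) + c) ≤ WithZero.exp (b : ℤ) := by
            calc Valued.v z * WithZero.exp ((b : ℤ) + c) ≤ Valued.v (ϖ ^ c) * WithZero.exp ((b : ℤ) + c) := mul_le_mul' hle le_rfl
              _ = WithZero.exp (b : ℤ) := by rw [hq, ← WithZero.exp_add]; congr 1; ring
          rcases hA1eq with h | h
          · rw [he₁, WithZero.exp_inj] at h; omega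
          · have : Valued.v (D 1) ≤ WithZero.exp (b : ℤ) := h ▸ hzle
            rw [he₁, WithZero.exp_le_exp] at this; omega
        have h2e0 : 2 * e₀ = (b : ℤ) + c := by omega
        have hWlt : Valued.v (x * z - y * ϖ ^ b) < 1 := by
          refine Valuation.map_sub_lt _ ?_ ?_
          · rw [map_mul, hx1, one_mul]
            refine lt_of_le_of_lt hle ?_
            rw [hq, ← WithZero.exp_zero, WithZero.exp_lt_exp]; omega
          · rw [map_mul, hq]
            calc Valued.v y * WithZero.exp (-(b : ℤ)) ≤ 1 * WithZero.exp (-(b : ℤ)) := mul_le_mul' hy le_rfl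
              _ < 1 := by rw [one_mul, ← WithZero.exp_zero, WithZero.exp_lt_exp]; omega
        rcases hA0eq with h | h | h
        · rw [he₀, ← WithZero.exp_zero, WithZero.exp_inj] at h; omega
        · rw [he₀, hx1, one_mul, WithZero.exp_inj] at h; omega
        · have hW1 : Valued.v (x * z - y * ϖ ^ b) = 1 := by
            have h' : Valued.v (x * z - y * ϖ ^ b) * WithZero.exp ((b : ℤ) + c) = 1 * WithZero.exp ((b : ℤ) + c) := by
              rw [one_mul, ← h, he₀, h2e0]
            exact mul_right_cancel₀ WithZero.exp_ne_zero h'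
          exact absurd hW1 hWlt.ne
      have hz0 : z ≠ 0 := fun h => by
        rw [h, map_zero] at hzc
        exact not_lt_of_ge zero_le hzc
      obtain ⟨mz, hmz⟩ : ∃ m : ℤ, Valued.v z = WithZero.exp m :=
        ⟨WithZero.log (Valued.v z), (WithZero.exp_log ((Valuation.ne_zero_iff _).2 hz0)).symm⟩
      have hmz0 : mz ≤ 0 := by rw [hmz, ← WithZero.exp_zero, WithZero.exp_le_exp] at hz; exact hz
      have hmzc : -(c : ℤ) < mz := by rw [hmz, hq, WithZero.exp_lt_exp] at hzc; exact hzc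
      -- (ii) `2e₁ = mz + b + c`, `2e₀ = b − mz`
      have h2e1 : 2 * e₁ = mz + b + c := by
        have hge : WithZero.exp (mz + (b + c)) ≤ Valued.v (D 1) := by
          have := hA1z; rwa [hmz, ← WithZero.exp_add] at this
        rw [he₁, WithZero.exp_le_exp] at hge
        rcases hA1eq with h | h
        · rw [he₁, WithZero.exp_inj] at h; omega
        · rw [he₁, hmz, ← WithZero.exp_add, WithZero.exp_inj] at h; omega
      have h2e0 : 2 * e₀ = (b : ℤ) - mz := by omega
      have vT1' : Valued.v (σ (ϖ ^ b) * D 1 * ϖ ^ b) = WithZero.exp (mz + c - b) := by rw [vT1]; congr 1; omega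
      have vT2' : Valued.v (σ z * D 2 * z) = WithZero.exp (2 * mz + c) := by
        rw [vT2, hmz, ← WithZero.exp_add, ← WithZero.exp_add]; congr 1; ring
      by_cases hmz00 : mz = 0
      · -- `|z| = 1`: `G₁₁ = D₁N(ϖ^b) + D₂N(z)` has valuation `exp c > 1` — not integral
        exfalso
        have hlt : Valued.v (σ (ϖ ^ b) * D 1 * ϖ ^ b) < Valued.v (σ z * D 2 * z) := by
          rw [vT1', vT2', WithZero.exp_lt_exp]; omega
        have h11 := hG11
        rw [Valuation.map_add_eq_of_lt_right _ hlt, vT2', ← WithZero.exp_zero, WithZero.exp_le_exp] at h11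
        omega
      · have hzlt1 : Valued.v z < 1 := by rw [hmz, ← WithZero.exp_zero, WithZero.exp_lt_exp]; omega
        have hy1 : Valued.v y = 1 := by
          rcases hN.2 with h | h | h
          · exact absurd ((hq_eq_one c).1 h) (by omega)
          · exact h
          · exact absurd h hzlt1.ne
        -- `|xz − yϖ^b| = exp(−mz − c)` (slot 0 is attained at the third entry)
        have hW : Valued.v (x * z - y * ϖ ^ b) = WithZero.exp (-mz - c) := by
          rcases hA0eq with h | h | h
          · rw [he₀, ← WithZero.exp_zero, WithZero.exp_inj] at h; omega
          · rw [he₀, hx1, one_mul, WithZero.exp_inj] at h; omega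
          · have h' : Valued.v (x * z - y * ϖ ^ b) * WithZero.exp ((b : ℤ) + c) = WithZero.exp (-mz - c) * WithZero.exp ((b : ℤ) + c) := by
              rw [← h, he₀, ← WithZero.exp_add]; congr 1; omega
            exact mul_right_cancel₀ WithZero.exp_ne_zero h'
        have vS1' : Valued.v (σ x * D 1 * x) = WithZero.exp (mz + b + c) := by rw [vS1, hx1, one_mul, one_mul, h2e1]
        have vS2' : Valued.v (σ y * D 2 * y) = WithZero.exp (c : ℤ) := by rw [vS2, hy1, one_mul, one_mul]
        have vD0' : Valued.v (D 0) = WithZero.exp ((b : ℤ) - mz) := by rw [he₀, h2e0]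
        by_cases hbmz : (b : ℤ) = -mz
        · -- `|z| = |ϖ|^b`: stratum H (`c = 2b`) or G₁ (`c = 2b + s`); `c ≥ 2b` because `|xz − yϖ^b| ≤ |ϖ|^b`
          have h2b : 2 * b ≤ c := by
            have hle : Valued.v (x * z - y * ϖ ^ b) ≤ WithZero.exp (-(b : ℤ)) := by
              refine Valuation.map_sub_le _ ?_ ?_
              · rw [map_mul, hx1, one_mul, hmz, WithZero.exp_le_exp]; omega
              · rw [map_mul, hq]; exact mul_le_of_le_one_left' hy
            rw [hW, WithZero.exp_le_exp] at hle
            omega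
          obtain ⟨s, hs⟩ := Nat.exists_eq_add_of_le h2b
          have hvz : Valued.v z = Valued.v (ϖ ^ b) := by rw [hmz, hq, WithZero.exp_inj]; omega
          have hvW : Valued.v (y * ϖ ^ b - x * z) = Valued.v (ϖ ^ (b + s)) := by
            rw [Valuation.map_sub_swap, hW, hq, WithZero.exp_inj]; push_cast; omega
          rcases Nat.eq_zero_or_pos s with hs0 | hspos
          · -- H
            refine Or.inr (Or.inr (Or.inr (Or.inr (Or.inr (Or.inr (Or.inr ⟨b, hbpos, rfl, by omega, hvz, hy1, ?_⟩))))))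
            rw [hvW, hs0, add_zero]
          · -- G₁
            exact Or.inr (Or.inr (Or.inr (Or.inr (Or.inl ⟨b, s, hbpos, by omega, by omega, rfl, by omega, hvz, hy1, hvW⟩))))
        · -- `|z| ≠ |ϖ|^b`: `G₁₁` has two terms of distinct valuation, both integral; then `G₀₀` forces an equality: G₂ or G₃
          have hne : Valued.v (σ (ϖ ^ b) * D 1 * ϖ ^ b) ≠ Valued.v (σ z * D 2 * z) := by
            rw [vT1', vT2', Ne, WithZero.exp_inj]; omega
          have h11 := hG11
          rw [Valuation.map_add_of_distinct_val _ hne, vT1', vT2', max_le_iff, ← WithZero.exp_zero, WithZero.exp_le_exp,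
            WithZero.exp_le_exp] at h11
          have h00 : ¬ (2 * mz + (c : ℤ) < 0 ∧ (c : ℤ) < b - mz) := by
            rintro ⟨h1, h2⟩
            have hlt : Valued.v (σ x * D 1 * x + σ y * D 2 * y) < Valued.v (D 0) := by
              refine Valuation.map_add_lt _ ?_ ?_
              · rw [vS1', vD0', WithZero.exp_lt_exp]; omega
              · rw [vS2', vD0', WithZero.exp_lt_exp]; omega
            have h0 := hG00
            rw [add_assoc, Valuation.map_add_eq_of_lt_left _ hlt, vD0', ← WithZero.exp_zero, WithZero.exp_le_exp] at h0
            omega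
          obtain ⟨ρ, hρ⟩ := hc_even
          by_cases h2 : 2 * mz + (c : ℤ) = 0
          · -- G₃: `|z| = |ϖ|^ρ`, `c = 2ρ`, `b = ρ + s`
            have hρb : ρ ≤ b := by omega
            obtain ⟨s, hs⟩ := Nat.exists_eq_add_of_le hρb
            refine Or.inr (Or.inr (Or.inr (Or.inr (Or.inr (Or.inr (Or.inl ⟨ρ, s, by omega, by omega, by omega, by omega, hs, ?_, hy1⟩))))))
            rw [hmz, hq, WithZero.exp_inj]; omega
          · -- G₂: `ρ = b`, `|z| = |ϖ|^{c − b}`, `c = 2b + s`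
            have h2b : 2 * b ≤ c := by omega
            obtain ⟨s, hs⟩ := Nat.exists_eq_add_of_le h2b
            refine Or.inr (Or.inr (Or.inr (Or.inr (Or.inr (Or.inl ⟨b, s, hbpos, by omega, by omega, rfl, by omega, ?_, hy1⟩)))))
            rw [hmz, hq, WithZero.exp_inj]; push_cast; omega

end Summit.HodgeConjecture.HodgeConjecture.Cruxes.H413.F0P3cDyRamDiagonalDualisableStrata

end
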